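import Summits.QuantumFields.BalabanUV.Beta.D1BFx.PackedStraightColumnMixedMass
import Summits.QuantumFields.BalabanUV.Beta.HessKerCoDressedBmWall

/-!
# `BalabanUV.Beta.D1BFx.RoadPinKernelDecay` — road «BF-x» for binder row D1, slot (K), PART 24 HEAD «TWO PINS», «G0-DECAY» (OWNER d1-p2 g25 W-g25-5 (b) l.53983:
# «WANTED (any lineage; natural home = yours or R-T's): `Decays (coDressKBmAt (ctr 4 n) n (KInvStep 3 n 0)) (C_G(n)) (δ_G(n))` with `C_G`, `δ_G` DISPLAYED closed expressions
# in `n` — the leg letter every row of the HEAD multiplies by»):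
# **THE STRAIGHT KERNEL `K₀ = KInvStep 3 n 0` AND THE ROAD KERNEL `G₀ = coDressKBmAt ρ_c n K₀` DECAY WITH DISPLAYED CONSTANTS — MODULO ONE DISPLAYED LETTER FOR THE
# ff BLOCK (the fluctuation covariance `Γ`, whose n-uniform decay is the (K)-wall's own content) and the multiplier envelope `hΦ`; the `ℋ`-columns are UNCONDITIONAL**

HONEST DEPENDENCY (cell records, verbatim): «continuum YM on T⁴ ⇐ BetaPertH ∧ nine spine estimates (0/9 proved); BetaPertH ⇐ (D1) ∧ (D4) ∧
CAP+tail; G-an2-4 gates asym, D1 and NE2/3/4.»  HONEST FRAMING (cell contract, verbatim): «discharging `BetaPertH` makes Bałaban's UV stability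
UNCONDITIONAL — a real constructive-QFT result; it is NOT the continuum limit and NOT the Clay problem.»  THIS MODULE DISCHARGES NOTHING of the
wall: [folklore] block-by-block bookkeeping BY NAME over LANDED objects (lit `OneStepResolventKernel.KInv_*` block identities, `ResolventComposition.GamΦ_eq_neg_wH`;
g60 `PackedStraightColumn.abs_colH_K₀_road_le`, g61 C′ `PackedStraightColumnMixedMass.abs_colM_K₀_le_of_wΦ`; an2's `HessKerCoDressedBmWall` transport ingredients
`decays_piKBm` ∕ `cPb` ∕ `BalabanStepJetsSucc.decays_comp` with the constant it already computes made a DISPLAYED output).  No definition, no `def … : Prop`, nothing cited,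
0 sorry.  TWO DISPLAYED HYPOTHESES: `hΓ : |Gam κ x l x′| ≤ CΓ·e^{−δΓ|x − x′|₁}` (the ff block — in the tree ONLY `KKTFluctuationKernel.decay_Gam : ∃ δ C` «existential PER N»;
an n-uniform displayed `(CΓ, δΓ)` is exactly the decay estimate the (K)-wall ∕ the G-an2-4 Combes–Thomas programme is about — NOT claimed here) and `hΦ` (the SHAPE of d4-p3's
`exists_wΦ_decay`; dischargeable by the typer's `CoarseLegJunction.abs_wΦ_le` ∕ d1-leaf-04's `StraightPinMultiplierEnvelope`).  0 root-level binders of row D1 discharged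
(hW ∕ hR-sockets ∕ hSX-socket ∕ D1Tel ∕ D1Rep = 0); (J1) ONE OPEN ROW; (K) NOT closed; NOT D1, NEVER «G-an2-4 closed», NOT `BetaPertH`, NOT continuum, NOT Clay.

ABSOLUTE RULE (cell charter, verbatim): «No internally-minted statement may enter as a cited fact. Every hypothesis is either kernel-proved in
this package or a verbatim quotation of a PUBLISHED theorem with page reference. The manuscript(s) under audit are NOT citable for their own
disputed steps — they are the thing under adjudication; programme-internal (2001/route/tribunal) claims are never citable.»

WHY.  Every tadpole ∕ bubble row of the HEAD (`ChartDefectHead` v1.1 `abs_secondMoment_chartDefect_le_of_decay510_rows`: (mcol) (ms) (lamf) (dd) (xb) (bb), and O-8's counts) reads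
`hA : Decays G₀ C_A δ_A` through lit `abs_tadpole_le ∕ abs_bubble_le ∕ decay510_hessKer`; in the tree `Decays G₀` is existential (`decays_coDressKBmAt_KInvStep`,
`exists_decays_coDressKBmAt : ∃ c`).  The straight kernel's four blocks have, entry by entry: ff = `Γ` (letter `hΓ`), fm ∕ mf = the `ℋ`-columns (`(n⁵)⁻¹·C₄e^{κ′}`, rate `κ′∕(4n)`,
UNCONDITIONAL — g53 ∕ g60; mf through `GamΦ = −ℋᵀ`), mm = `wΦ` (`CΦ·(n⁵)⁻¹·(n³)⁻¹·e^{κ₀}`, rate `κ₀∕(4n)`, modulo `hΦ` — g61 C′), zero off the coarse sublattice; so `K₀` decays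
with the SUM of the three constants at the common rate, and an2's block-mean co-dressing transport (`(1−Π_bm)ᵀ K (1−Π_bm)`: `decays_piKBm` at every rate, `decays_comp` twice)
carries it to `G₀` with the factor `|Fib 3|²·cPb 3 n δ·cPb 3 n (δ∕2)·Zl 4 (δ∕2)·Zl 4 (δ∕4)` and rate `δ∕4` — every symbol a closed expression (`cPb d N δ = (1 + 4(d+1)N)·e^{δ(d+1)N}`).

CONTENT (`K₀ := KInvStep 3 n 0 = KInv` (`KInvStep_zero_eq`); `C_col := (n⁵)⁻¹·C₄·e^{κ′}`, `C₄ := MG163 4·periodConst (kappa163 4) 3`, `κ′ := kappa163 4 ∕ 4`;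
`C_M := CΦ·(n⁵)⁻¹·(n³)⁻¹·e^{κ₀}`; `δ₀ := min δΓ (min (κ′∕(4n)) (κ₀∕(4n)))`).
* §1 **`decays_K₀_of_blocks`** (`hΓ`, `hΦ`, `0 ≤ CΓ`, `0 < κ₀` ⟹ `Decays K₀ (CΓ + C_col + C_col + C_M) δ₀`).
* §2 **`decays_coDressKBmAt_explicit`** (any `d`, in-block root `r`, any `K`, `0 < δ`: `Decays K C δ → Decays (coDressKBmAt (toSite r) N K) ((|Fib d|²·(cPb d N δ·cPb d N (δ∕2))·
  (Zl (d+1) (δ∕2)·Zl (d+1) (δ∕4)))·C) (δ∕4)` — an2's `exists_decays_coDressKBmAt` with its constant DISPLAYED).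
* §3 **`decays_G₀_record`** (`hΓ`, `hΦ` ⟹ `Decays (coDressKBmAt (ctr 4 n) n K₀) (C_G) (δ₀∕4)`, `C_G` the displayed product) — the «G0-DECAY» letter.
NOT HERE (honest): any n-law for `(CΓ, δΓ)` (the wall's); whether `δ₀∕4 ≍ 1∕n` and `Zl 4 (δ₀∕8)·cPb² ≍ n⁸·e^{…}` make a HEAD row n-free (the pricing seats'); any (1.22) row.
Unit `b2b-balaban-gan24-formalise-leaf-05` (gen 62), G-an2-4 swarm leaf prover 05, road «BF-x» supplier; INTENT-5 «G0-DECAY» (journal [GAN24LEAF05-G62-INTENT-5]).  No existing file touched.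
-/

noncomputable section

open Literature.MathematicalPhysics.QuantumFieldTheory
open Literature.MathematicalPhysics.QuantumFieldTheory.Balaban1983to89
open Literature.MathematicalPhysics.QuantumFieldTheory.Balaban1983to89.Beta
open B12Sec2to5 (l1 l1_nonneg)
open B4ContourShift (supNorm)
open B5Hk163Strip (kappa163 kappa163_pos)
open B5Hk163Decay (MG163)
open B4TorusKernel (periodConst)
open ExpKernelCalculus (Site MKer Zl Zl_pos Zl_nonneg Decays comp l1_sub_symm)
open AffineAveraging (box toSite)
open AveragingContoursRooted (ctr ctrOff ctrOff_mem_box)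
open KernelSpecInstance (wΦ)
open KKTFluctuationKernel (Gam)
open Literature.MathematicalPhysics.QuantumFieldTheory.LatticeForm (quo)
open OneStepResolventKernel (Fib KInv KInv_inl_inl KInv_inl_inr_coarse KInv_inr_inl_coarse KInv_inr_inr_coarse KInv_inl_inr_off KInv_inr_off
  eq_zsmul_quo_of_proj bound_mono)
open OneStepKernelFamily (colH KInvStep)
open SecondOrderResponse (colM)
open ResolventComposition (GamΦ_eq_neg_wH)
open Summit.QuantumFields.BalabanUV.Beta.BorderedHessian (KInvStep_zero_eq)
open Summit.QuantumFields.BalabanUV.Beta.AxialDressingRooted (coDressKBmAt piKBm cPb cPb_nonneg decays_piKBm coDressKBmAt_eq)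
open Summit.QuantumFields.BalabanUV.Beta.TameKernelCalculus (trK decays_trK)
open Summit.QuantumFields.BalabanUV.Beta.D1BFx.PackedStraightColumn (abs_colH_K₀_road_le)
open Summit.QuantumFields.BalabanUV.Beta.D1BFx.PackedStraightColumnMixedMass (abs_colM_K₀_le_of_wΦ)

namespace Summit.QuantumFields.BalabanUV.Beta.D1BFx.RoadPinKernelDecay

/-! ## §1 The straight kernel decays, block by block, constants displayed -/

section Straight

variable (n : ℕ) [NeZero n]

/-- [folklore] **THE STRAIGHT PACKED KERNEL DECAYS WITH DISPLAYED CONSTANTS** (modulo the ff letter `hΓ` and the multiplier envelope `hΦ`): with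
`C_col := (n⁵)⁻¹·C₄e^{κ′}` (g60 `abs_colH_K₀_road_le`, BOTH `ℋ`-columns — the mf block through `GamΦ = −ℋᵀ`), `C_M := CΦ·(n⁵)⁻¹·(n³)⁻¹·e^{κ₀}` (g61 C′ `abs_colM_K₀_le_of_wΦ`) and
`δ₀ := min δΓ (min (κ′∕(4n)) (κ₀∕(4n)))`: `Decays (KInvStep 3 n 0) (CΓ + C_col + C_col + C_M) δ₀` — entries off the coarse sublattice vanish. -/
theorem decays_K₀_of_blocks {CΓ δΓ : ℝ} (hCΓ : 0 ≤ CΓ)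
    (hΓ : ∀ (κ : Fin (3 + 1)) (x : Site 4) (l : Fin (3 + 1)) (x' : Site 4),
      |Gam (N := n) κ x l x'| ≤ CΓ * Real.exp (-δΓ * l1 (x - x')))
    {CΦ κ₀ : ℝ} (hκ₀ : 0 < κ₀)
    (hΦ : ∀ (ρ ν : Fin (3 + 1)) (w : Fin (3 + 1) → ℤ),
      |wΦ (N := n) ρ ν w| ≤ CΦ * ((n : ℝ) ^ 5)⁻¹ * ((n : ℝ) ^ 3)⁻¹ * Real.exp (-(κ₀ * supNorm w))) :
    Decays (KInvStep (d := 3) n 0)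
      (CΓ + (((n : ℝ) ^ 5)⁻¹ * ((MG163 4 * periodConst (kappa163 4) 3) * Real.exp (kappa163 4 / 4)))
        + (((n : ℝ) ^ 5)⁻¹ * ((MG163 4 * periodConst (kappa163 4) 3) * Real.exp (kappa163 4 / 4)))
        + (CΦ * ((n : ℝ) ^ 5)⁻¹ * ((n : ℝ) ^ 3)⁻¹ * Real.exp κ₀))
      (min δΓ (min (kappa163 4 / 4 / (4 * (n : ℝ))) (κ₀ / (4 * (n : ℝ))))) := by
  set Ccol : ℝ := ((n : ℝ) ^ 5)⁻¹ * ((MG163 4 * periodConst (kappa163 4) 3) * Real.exp (kappa163 4 / 4)) with hCcol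
  set CM : ℝ := CΦ * ((n : ℝ) ^ 5)⁻¹ * ((n : ℝ) ^ 3)⁻¹ * Real.exp κ₀ with hCM
  set δ₀ : ℝ := min δΓ (min (kappa163 4 / 4 / (4 * (n : ℝ))) (κ₀ / (4 * (n : ℝ)))) with hδ₀
  have hcol := abs_colH_K₀_road_le n
  have hM := abs_colM_K₀_le_of_wΦ n hκ₀.le hΦ
  have hCcol0 : 0 ≤ Ccol := (mul_nonneg_iff_of_pos_right (Real.exp_pos _)).1 ((abs_nonneg _).trans (hcol 0 0 0 0))
  have hCM0 : 0 ≤ CM := (mul_nonneg_iff_of_pos_right (Real.exp_pos _)).1 ((abs_nonneg _).trans (hM 0 0 0 0))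
  have hδΓ : δ₀ ≤ δΓ := min_le_left _ _
  have hδc : δ₀ ≤ kappa163 4 / 4 / (4 * (n : ℝ)) := (min_le_right _ _).trans (min_le_left _ _)
  have hδm : δ₀ ≤ κ₀ / (4 * (n : ℝ)) := (min_le_right _ _).trans (min_le_right _ _)
  have hsum1 : CΓ ≤ CΓ + Ccol + Ccol + CM := by linarith
  have hsum2 : Ccol ≤ CΓ + Ccol + Ccol + CM := by linarith
  have hsum3 : CM ≤ CΓ + Ccol + Ccol + CM := by linarith
  have hK : KInvStep (d := 3) n 0 = KInv (N := n) := KInvStep_zero_eq (Lc := n)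
  intro x y a b
  rw [hK]
  have hzero : |(0 : ℝ)| ≤ (CΓ + Ccol + Ccol + CM) * Real.exp (-δ₀ * (l1 (x - y))) := by
    rw [abs_zero]; exact mul_nonneg (by linarith) (Real.exp_pos _).le
  rcases a with κ | κ <;> rcases b with l | l
  · -- ff: the fluctuation covariance `Γ`
    rw [KInv_inl_inl]
    exact bound_mono (hΓ κ x l y) hCΓ hsum1 hδΓ (l1_nonneg _)
  · -- fm: the `ℋ`-column at the coarse point `y`
    by_cases hy : Literature.Probability.LatticeModels.Torus.proj n y = 0
    · have ey : y = (n : ℤ) • quo n y := eq_zsmul_quo_of_proj hy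
      have h1 : |KInv (N := n) x y (Sum.inl κ) (Sum.inr l)| ≤ Ccol * Real.exp (-(kappa163 4 / 4 / (4 * (n : ℝ))) * l1 (x - y)) := by
        have h := hcol l (quo n y) κ x
        rw [← ey] at h
        rw [ey, KInv_inl_inr_coarse, ← ey]
        have e : colH (KInvStep (d := 3) n 0) n l (quo n y) κ x = KernelSpecInstance.wH (N := n) κ l (x - y) := by
          show KInvStep (d := 3) n 0 x ((n : ℤ) • quo n y) (Sum.inl κ) (Sum.inr l) = _
          rw [hK, KInv_inl_inr_coarse, ← ey]
        rw [← e]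
        exact h
      exact bound_mono h1 hCcol0 hsum2 hδc (l1_nonneg _)
    · rw [KInv_inl_inr_off hy]
      exact hzero
  · -- mf: `GamΦ = −ℋᵀ`, the `ℋ`-column at the coarse point `x`
    by_cases hx : Literature.Probability.LatticeModels.Torus.proj n x = 0
    · have ex : x = (n : ℤ) • quo n x := eq_zsmul_quo_of_proj hx
      have h1 : |KInv (N := n) x y (Sum.inr κ) (Sum.inl l)| ≤ Ccol * Real.exp (-(kappa163 4 / 4 / (4 * (n : ℝ))) * l1 (x - y)) := by
        have h := hcol κ (quo n x) l y
        rw [← ex, l1_sub_symm y x] at h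
        rw [ex, KInv_inr_inl_coarse, GamΦ_eq_neg_wH, ← ex, abs_neg]
        have e : colH (KInvStep (d := 3) n 0) n κ (quo n x) l y = KernelSpecInstance.wH (N := n) l κ (y - x) := by
          show KInvStep (d := 3) n 0 y ((n : ℤ) • quo n x) (Sum.inl l) (Sum.inr κ) = _
          rw [hK, KInv_inl_inr_coarse, ← ex]
        rw [← e]
        exact h
      exact bound_mono h1 hCcol0 hsum2 hδc (l1_nonneg _)
    · rw [KInv_inr_off hx]
      exact hzero
  · -- mm: the multiplier response `wΦ` at two coarse points
    by_cases hx : Literature.Probability.LatticeModels.Torus.proj n x = 0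
    · by_cases hy : Literature.Probability.LatticeModels.Torus.proj n y = 0
      · have ex : x = (n : ℤ) • quo n x := eq_zsmul_quo_of_proj hx
        have ey : y = (n : ℤ) • quo n y := eq_zsmul_quo_of_proj hy
        have h1 : |KInv (N := n) x y (Sum.inr κ) (Sum.inr l)| ≤ CM * Real.exp (-(κ₀ / (4 * (n : ℝ))) * l1 (x - y)) := by
          have h := hM l (quo n y) κ (quo n x)
          rw [← ex, ← ey] at h
          have e : colM (KInvStep (d := 3) n 0) n l (quo n y) κ (quo n x) = KInv (N := n) x y (Sum.inr κ) (Sum.inr l) := by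
            show KInvStep (d := 3) n 0 ((n : ℤ) • quo n x) ((n : ℤ) • quo n y) (Sum.inr κ) (Sum.inr l) = _
            rw [hK, ← ex, ← ey]
          rw [← e]
          exact h
        exact bound_mono h1 hCM0 hsum3 hδm (l1_nonneg _)
      · have e : KInv (N := n) x y (Sum.inr κ) (Sum.inr l) = 0 := by
          simp only [OneStepResolventKernel.KInv, hy, and_false, if_false]
        rw [e]
        exact hzero
    · rw [KInv_inr_off hx]
      exact hzero

end Straight

/-! ## §2 an2's block-mean co-dressing transport with its constant DISPLAYED -/

/-- [folklore] **DECAY TRANSPORT THROUGH THE BLOCK-MEAN CO-DRESSING, CONSTANT DISPLAYED** (an2's `HessKerCoDressedBmWall.exists_decays_coDressKBmAt` — same proof, the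
`∃ c` opened): for `1 ≤ N`, an in-block root `r ∈ box (d+1) N`, `0 < δ`, ANY `K` with `Decays K C δ`,
`Decays (coDressKBmAt (toSite r) N K) ((|Fib d|²·(cPb d N δ·cPb d N (δ∕2))·(Zl (d+1) (δ∕2)·Zl (d+1) (δ∕4)))·C) (δ∕4)`, `cPb d N δ = (1 + 4(d+1)N)·e^{δ(d+1)N}`. -/
theorem decays_coDressKBmAt_explicit {d N : ℕ} (hN : 1 ≤ N) {r : Fin (d + 1) → ℕ} (hr : r ∈ box (d + 1) N) {δ : ℝ} (hδ : 0 < δ)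
    {K : MKer (d + 1) (Fib d)} {C : ℝ} (hK : Decays K C δ) :
    Decays (coDressKBmAt (toSite r) N K)
      (((Fintype.card (Fib d) : ℝ) ^ 2 * (cPb d N δ * cPb d N (δ / 2)) * (Zl (d + 1) (δ / 2) * Zl (d + 1) (δ / 4))) * C) (δ / 4) := by
  have hPt : Decays (trK (piKBm (toSite r) N)) (cPb d N δ) δ := decays_trK (decays_piKBm hN hr hδ.le)
  have h1 := BalabanStepJetsSucc.decays_comp hPt hK (show (0 : ℝ) ≤ δ / 2 by linarith) (show δ / 2 < δ by linarith)
  rw [show δ - δ / 2 = δ / 2 by ring] at h1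
  have hP : Decays (piKBm (toSite r) N) (cPb d N (δ / 2)) (δ / 2) := decays_piKBm hN hr (by linarith)
  have h2 := BalabanStepJetsSucc.decays_comp h1 hP (show (0 : ℝ) ≤ δ / 4 by linarith) (show δ / 4 < δ / 2 by linarith)
  rw [show δ / 2 - δ / 4 = δ / 4 by ring] at h2
  rw [coDressKBmAt_eq]
  exact OneStepResolventKernel.decays_mono h2 (h2.nonneg (Sum.inl 0)) (le_of_eq (by ring)) le_rfl

/-! ## §3 The road kernel at the record -/

section Record

variable (n : ℕ) [NeZero n]

/-- [folklore] **«G0-DECAY»: THE ROAD KERNEL `G₀ = coDressKBmAt ρ_c n K₀` DECAYS WITH DISPLAYED CONSTANTS** (modulo `hΓ` — the ff block's letter — and `hΦ`; `0 ≤ CΓ`,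
`0 < δΓ`, `0 < κ₀`): with `δ₀ := min δΓ (min (κ′∕(4n)) (κ₀∕(4n)))` and `C_K := CΓ + C_col + C_col + C_M` (§1),
`Decays (coDressKBmAt (ctr 4 n) n (KInvStep 3 n 0)) ((|Fib 3|²·(cPb 3 n δ₀·cPb 3 n (δ₀∕2))·(Zl 4 (δ₀∕2)·Zl 4 (δ₀∕4)))·C_K) (δ₀∕4)` — §2 at the centred root over §1.
The leg letter `hA` of lit `abs_tadpole_le ∕ abs_bubble_le ∕ decay510_hessKer` for every row of the HEAD, closed modulo `(CΓ, δΓ)`. -/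
theorem decays_G₀_record {CΓ δΓ : ℝ} (hCΓ : 0 ≤ CΓ) (hδΓ : 0 < δΓ)
    (hΓ : ∀ (κ : Fin (3 + 1)) (x : Site 4) (l : Fin (3 + 1)) (x' : Site 4),
      |Gam (N := n) κ x l x'| ≤ CΓ * Real.exp (-δΓ * l1 (x - x')))
    {CΦ κ₀ : ℝ} (hκ₀ : 0 < κ₀)
    (hΦ : ∀ (ρ ν : Fin (3 + 1)) (w : Fin (3 + 1) → ℤ),
      |wΦ (N := n) ρ ν w| ≤ CΦ * ((n : ℝ) ^ 5)⁻¹ * ((n : ℝ) ^ 3)⁻¹ * Real.exp (-(κ₀ * supNorm w))) :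
    Decays (coDressKBmAt (ctr 4 n) n (KInvStep (d := 3) n 0))
      (((Fintype.card (Fib 3) : ℝ) ^ 2
          * (cPb 3 n (min δΓ (min (kappa163 4 / 4 / (4 * (n : ℝ))) (κ₀ / (4 * (n : ℝ)))))
              * cPb 3 n (min δΓ (min (kappa163 4 / 4 / (4 * (n : ℝ))) (κ₀ / (4 * (n : ℝ)))) / 2))
          * (Zl (3 + 1) (min δΓ (min (kappa163 4 / 4 / (4 * (n : ℝ))) (κ₀ / (4 * (n : ℝ)))) / 2)
              * Zl (3 + 1) (min δΓ (min (kappa163 4 / 4 / (4 * (n : ℝ))) (κ₀ / (4 * (n : ℝ)))) / 4)))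
        * (CΓ + (((n : ℝ) ^ 5)⁻¹ * ((MG163 4 * periodConst (kappa163 4) 3) * Real.exp (kappa163 4 / 4)))
            + (((n : ℝ) ^ 5)⁻¹ * ((MG163 4 * periodConst (kappa163 4) 3) * Real.exp (kappa163 4 / 4)))
            + (CΦ * ((n : ℝ) ^ 5)⁻¹ * ((n : ℝ) ^ 3)⁻¹ * Real.exp κ₀)))
      (min δΓ (min (kappa163 4 / 4 / (4 * (n : ℝ))) (κ₀ / (4 * (n : ℝ)))) / 4) := by
  have hn : 1 ≤ n := Nat.one_le_iff_ne_zero.2 (NeZero.ne n)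
  have hn0 : (0 : ℝ) < (n : ℝ) := by exact_mod_cast hn
  have hδ₀ : 0 < min δΓ (min (kappa163 4 / 4 / (4 * (n : ℝ))) (κ₀ / (4 * (n : ℝ)))) :=
    lt_min hδΓ (lt_min (by have := kappa163_pos 4; positivity) (by positivity))
  exact decays_coDressKBmAt_explicit (d := 3) hn (ctrOff_mem_box hn) hδ₀ (decays_K₀_of_blocks n hCΓ hΓ hκ₀ hΦ)

end Record

end Summit.QuantumFields.BalabanUV.Beta.D1BFx.RoadPinKernelDecay

end
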